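/-
Copyright: the b2b-balaban cell (near-miss cell 7), T⁴-continuum fan-out, lineage t4-ne7b-p3 (node U5c LARGE-DEVIATION
member P3).  Released under the licence of the surrounding project.
-/
import Summits.QuantumFields.BalabanUV.T4Continuum.Support.SpaceTimeOccTorus

/-!
# Space-time Peierls ∕ Cramér route for NE7b — SEPARATION REDUCED TO PRINT's MERGER CRITERION: distinct lineages that
# «neither intersect nor touch» at each step are separated in the space-time cell graph

Summits-side support leaf of the T⁴-continuum cell (rung (B)+1 on a FINITE torus only; NOT infinite volume, NOT the
mass gap, NOT the Clay statement; NOT a proof of the spine estimate NE7b).  Lineage `t4-ne7b-p3` (generation 2), node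
U5c, skeleton `t4/skeletons/NE7b-t4-ne7b-p3.md` §11–§12.  [folklore] finite combinatorics over `SpaceTimeOccTorus`
(`LinData`, `InLin`, `Separated`), `SpaceTimeOccupancy` (`occAt`, `iterAt_subset_occAt`), `SpaceTimeTorusDict`
(`toCell`, `blockIdx_toCell_eq`) and the COUNT member's `HistoryRealiseCells.coarse_mem_Sop` (BY NAME); nothing
printed is asserted; no `[cite:]` tag.

WHAT.  The hypothesis `LinData.Separated` of `LinData.lineageReadings` (cells of distinct lineages of one term are
distinct and NOT ADJACENT — laterally or vertically) is reduced to the purely LATERAL reading `LinData.LatSeparated`: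
at every step, the cells of distinct lineages of one term are distinct and not laterally adjacent — print's «distinct
live components neither intersect nor touch» (the contrapositive of the merger criterion).  The vertical half is
PROVED: the occupied index sets of a `SkelOK` lineage are closed under the parent map (`coarse_mem_occAt_succ`: the
S-operation is expansive modulo re-blocking), so a vertical edge from a cell of `λ₁` at step `u` to a cell of `λ₂` at
step `u + 1` would make the parent cell common to both lineages at step `u + 1`.
* §1 `exists_event_of_mem_occAt` (under `SkelOK` an occupied point lies in the iterate of an event born by then),
  `coarse_mem_iterAt_succ`, `coarse_mem_occAt_succ`.
* §2 `eq_of_isScale_of_blockIdx_eq` (two scale-`t` cells with equal level-`t` blocks are equal), `cycd_eq_zero_iff_of_lt`.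
* §3 `LinData.LatSeparated`, `LinData.no_vertical_edge`, **`LinData.separated_of_lat`**.

HONEST DEPENDENCY (cell, verbatim): continuum YM on T⁴ ⇐ BetaPertH ∧ nine spine estimates (0/9 proved); BetaPertH ⇐
(D1) ∧ (D4) ∧ CAP+tail; G-an2-4 gates asym, D1 and NE2/3/4.  This file changes none of it.
-/

open Finset

namespace Summit.QuantumFields.BalabanUV.T4Continuum.SpaceTimePeierls

open Literature.MathematicalPhysics.QuantumFieldTheory.Balaban1983to89
open Literature.MathematicalPhysics.QuantumFieldTheory.Balaban1983to89.B13ScaleTransfer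
open Literature.MathematicalPhysics.QuantumFieldTheory.Balaban1983to89.B16SProfile
open T4PersistenceDictionary
open Summit.QuantumFields.BalabanUV.T4Continuum.ZoneTorus
open Summit.QuantumFields.BalabanUV.T4Continuum.HistoryRealiseCells (coarse_mem_Sop)
open SpaceTimePeierlsLeaves

noncomputable section

open Classical

/-! ## §1 Occupied index sets are closed under the parent map -/

section Parent

variable {d : ℕ} {ε : Type*} [DecidableEq ε] {q : ℕ → ℕ} {step : ε → ℕ} {piece : ε → Finset (Pt d)}
  {fat : ε → ℕ} {dC : ℝ}

/-- membership in a realised domain: in the iterate of some event's piece [folklore] -/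
theorem mem_dom_iff {G : Gen ε} {u : ℕ} {y : Pt d} :
    y ∈ dom q step piece G u ↔ ∃ e ∈ G.events, y ∈ iterAt q (step e) u (piece e) := by
  unfold dom
  rw [mem_biUnion]

/-- **AN OCCUPIED POINT LIES IN THE ITERATE OF AN EVENT BORN BY THEN** (under `SkelOK`: the structure alive at `u`
consists of events of step `≤ u`). [folklore] -/
theorem exists_event_of_mem_occAt :
    ∀ {G : Gen ε}, SkelOK q step piece fat dC G → ∀ {u : ℕ} {y : Pt d}, y ∈ occAt q step piece G u →
      ∃ e ∈ G.events, step e ≤ u ∧ y ∈ iterAt q (step e) u (piece e)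
  | Gen.born b j, hok, u, y, hy => by
      have hj : step b = j := hok.1
      by_cases hju : j ≤ u
      · simp only [occAt, hju, if_true] at hy
        obtain ⟨e, he, hye⟩ := mem_dom_iff.1 hy
        rw [Gen.events_born, mem_singleton] at he
        subst he
        exact ⟨e, by simp, by omega, hye⟩
      · simp [occAt, hju] at hy
  | Gen.renew G e h, hok, u, y, hy => by
      obtain ⟨hG, -, hse, hchron⟩ := hok
      by_cases hcase : h + 1 ≤ u
      · simp only [occAt, hcase, if_true] at hy
        obtain ⟨e', he', hye⟩ := mem_dom_iff.1 hy
        refine ⟨e', he', ?_, hye⟩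
        rw [Gen.events_renew, mem_insert] at he'
        rcases he' with rfl | he'
        · omega
        · exact (hchron e' he').trans hcase
      · simp only [occAt, hcase, if_false] at hy
        obtain ⟨e', he', hs, hye⟩ := exists_event_of_mem_occAt hG hy
        exact ⟨e', by rw [Gen.events_renew]; exact mem_insert_of_mem he', hs, hye⟩
  | Gen.merge X Y e, hok, u, y, hy => by
      obtain ⟨hX, hY, hcX, hcY, -⟩ := hok
      by_cases hcase : step e ≤ u
      · simp only [occAt, hcase, if_true] at hy
        obtain ⟨e', he', hye⟩ := mem_dom_iff.1 hy
        refine ⟨e', he', ?_, hye⟩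
        rw [Gen.events_merge, mem_insert, mem_union] at he'
        rcases he' with rfl | he' | he'
        · exact hcase
        · exact (hcX e' he').trans hcase
        · exact (hcY e' he').trans hcase
      · simp only [occAt, hcase, if_false] at hy
        rcases mem_union.1 hy with hy | hy
        · obtain ⟨e', he', hs, hye⟩ := exists_event_of_mem_occAt hX hy
          exact ⟨e', by rw [Gen.events_merge, mem_insert, mem_union]; exact Or.inr (Or.inl he'), hs, hye⟩
        · obtain ⟨e', he', hs, hye⟩ := exists_event_of_mem_occAt hY hy
          exact ⟨e', by rw [Gen.events_merge, mem_insert, mem_union]; exact Or.inr (Or.inr he'), hs, hye⟩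

/-- **THE S-ITERATES ARE CLOSED UNDER THE PARENT MAP**: the `q u`-block of a point of the iterate at step `u ≥ s`
is a point of the iterate at step `u + 1` (`coarse_mem_Sop`). [folklore] -/
theorem coarse_mem_iterAt_succ {s u : ℕ} (hsu : s ≤ u) {Z : Finset (Pt d)} {y : Pt d} (hy : y ∈ iterAt q s u Z) :
    coarse (q u) y ∈ iterAt q s (u + 1) Z := by
  unfold iterAt at hy ⊢
  rw [show u + 1 - s = (u - s) + 1 by omega, Siter_succ, show s + (u - s) = u by omega]
  exact coarse_mem_Sop _ hy

/-- **THE OCCUPIED INDEX SETS ARE CLOSED UNDER THE PARENT MAP** (under `SkelOK`). [folklore] -/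
theorem coarse_mem_occAt_succ {G : Gen ε} (hok : SkelOK q step piece fat dC G) {u : ℕ} {y : Pt d}
    (hy : y ∈ occAt q step piece G u) : coarse (q u) y ∈ occAt q step piece G (u + 1) := by
  obtain ⟨e, he, hsu, hye⟩ := exists_event_of_mem_occAt hok hy
  exact iterAt_subset_occAt hok he (by omega) (coarse_mem_iterAt_succ hsu hye)

end Parent

/-! ## §2 Two scale-`t` cells with equal level-`t` blocks are equal -/

section Blocks

variable {d : ℕ}

/-- below the modulus the cyclic distance vanishes only on the diagonal [folklore] -/
theorem cycd_eq_zero_iff_of_lt {m a b : ℕ} (ha : a < m) (hb : b < m) : cycd m a b = 0 ↔ a = b := by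
  constructor
  · intro h
    unfold cycd at h
    rcases Nat.le_total a b with hab | hab
    · rw [Nat.dist_eq_sub_of_le hab] at h
      omega
    · rw [Nat.dist_eq_sub_of_le_right hab] at h
      omega
  · rintro rfl
    exact cycd_self m a

/-- **TWO CELLS OF SCALE `t` WITH THE SAME LEVEL-`t` BLOCK ARE EQUAL.** [folklore] -/
theorem eq_of_isScale_of_blockIdx_eq {N L t : ℕ} {x y : TCell d N} (hx : IsScale L t x) (hy : IsScale L t y)
    (h : ∀ i, (x i).val / L ^ t = (y i).val / L ^ t) : x = y := by
  funext i
  apply Fin.ext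
  obtain ⟨a, ha⟩ := hx i
  obtain ⟨b, hb⟩ := hy i
  have hi := h i
  rcases Nat.eq_zero_or_pos (L ^ t) with h0 | hpos
  · rw [ha, hb, h0, zero_mul, zero_mul]
  · rw [ha, hb, Nat.mul_div_cancel_left _ hpos, Nat.mul_div_cancel_left _ hpos] at hi
    rw [ha, hb, hi]

end Blocks

/-! ## §3 Lateral separation suffices -/

namespace LinData

variable {d n L Kx K : ℕ} {ℓ : ℕ → ℕ} {ι Λ ε : Type*} (D : LinData d n L Kx K ℓ ι Λ ε) [DecidableEq ε]
  {fat : ε → ℕ} {dC : ℝ}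

/-- **LATERAL SEPARATION** (print's «distinct live components neither intersect nor touch», per step): cells OF THE
SAME STEP of distinct lineages of one term are distinct and not laterally adjacent. [folklore] -/
structure LatSeparated : Prop where
  /-- same-step cells of distinct lineages of one term are distinct and not laterally adjacent -/
  sep : ∀ τ ∈ D.T, ∀ lam₁ ∈ D.fam τ, ∀ lam₂ ∈ D.fam τ, lam₁ ≠ lam₂ → ∀ c₁ c₂ : STCellV d n L Kx K ℓ,
    D.InLin lam₁ c₁ → D.InLin lam₂ c₂ → c₁.sc = c₂.sc →
      c₁ ≠ c₂ ∧ ¬ nearT n L Kx c₁.pt (ℓ c₁.sc) c₂.pt (ℓ c₂.sc) (ℓ c₁.sc) 1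

/-- **NO VERTICAL EDGE BETWEEN DISTINCT LINEAGES**: if the cell `c₂` (lineage `λ₂`, step `c₁.sc + 1`) is the parent
of the cell `c₁` (lineage `λ₁`), then the parent cell of `c₁` — a cell of `λ₁` at step `c₁.sc + 1` by the closure of
occupied sets under the parent map — equals `c₂`, contradicting lateral separation at step `c₁.sc + 1`. [folklore] -/
theorem no_vertical_edge (hL : 0 < L) (hmono : ∀ u, ℓ u ≤ ℓ (u + 1)) (hq : ∀ u, D.q u = L ^ (ℓ (u + 1) - ℓ u))
    (hlat : D.LatSeparated) {τ : ι} (hτ : τ ∈ D.T) {lam₁ lam₂ : Λ} (h₁ : lam₁ ∈ D.fam τ) (h₂ : lam₂ ∈ D.fam τ)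
    (hne : lam₁ ≠ lam₂) (hok : SkelOK D.q D.step D.piece fat dC (D.G lam₁)) {c₁ c₂ : STCellV d n L Kx K ℓ}
    (hc₁ : D.InLin lam₁ c₁) (hc₂ : D.InLin lam₂ c₂) (hsc : c₁.sc + 1 = c₂.sc)
    (hnear : nearT n L Kx c₁.pt (ℓ c₁.sc) c₂.pt (ℓ c₂.sc) (ℓ c₂.sc) 0) : False := by
  obtain ⟨y₁, hy₁, hpt₁⟩ := hc₁
  obtain ⟨htKx, -, hsc₂, hblocks⟩ := hnear
  -- the parent point and its cell, a cell of `λ₁` at step `c₂.sc`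
  set p : Pt d := coarse (D.q c₁.sc) y₁ with hp
  have hpocc : p ∈ occAt D.q D.step D.piece (D.G lam₁) c₂.sc := by
    rw [← hsc]; exact coarse_mem_occAt_succ hok hy₁
  let c' : STCellV d n L Kx K ℓ :=
    ⟨(c₂.1.1, toCell (n * L ^ Kx) (L ^ ℓ c₂.sc) D.hN p),
      isScale_toCell D.hN ((pow_dvd_pow L htKx).mul_left n) p⟩
  have hc'sc : c'.sc = c₂.sc := rfl
  have hc'in : D.InLin lam₁ c' := ⟨p, hpocc, rfl⟩
  -- the blocks: `c₁`'s level-`ℓ c₂.sc` block is `c'`'s, and equals `c₂`'s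
  obtain ⟨e, he⟩ : ∃ e, ℓ c₂.sc = ℓ c₁.sc + e := ⟨ℓ c₂.sc - ℓ c₁.sc, by have := hmono c₁.sc; rw [hsc] at this; omega⟩
  have hNdef : n * L ^ Kx = L ^ (ℓ c₁.sc + e) * (n * L ^ (Kx - (ℓ c₁.sc + e))) := by
    rw [mul_left_comm, ← pow_add, Nat.add_sub_cancel' (he ▸ htKx)]
  have hc : 0 < n * L ^ (Kx - (ℓ c₁.sc + e)) := by
    have := D.hN
    rcases Nat.eq_zero_or_pos n with h0 | hn
    · rw [h0, zero_mul] at this; exact absurd this (lt_irrefl 0)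
    · exact Nat.mul_pos hn (pow_pos hL _)
  have hqe : D.q c₁.sc = L ^ e := by rw [hq, hsc, he, Nat.add_sub_cancel_left]
  have heq : c'.pt = c₂.pt := by
    refine eq_of_isScale_of_blockIdx_eq c'.2 hsc₂ fun i => ?_
    have hb := hblocks i
    have hlt : ∀ (z : TCell d (n * L ^ Kx)), (z i).val / L ^ ℓ c₂.sc < n * L ^ (Kx - ℓ c₂.sc) := fun z => by
      apply Nat.div_lt_of_lt_mul
      have hz : (z i).val < n * L ^ Kx := (z i).isLt
      have hN' : n * L ^ Kx = L ^ ℓ c₂.sc * (n * L ^ (Kx - ℓ c₂.sc)) := by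
        rw [mul_left_comm, ← pow_add, Nat.add_sub_cancel' htKx]
      omega
    have h0 : cycd (n * L ^ (Kx - ℓ c₂.sc)) ((c₁.pt i).val / L ^ ℓ c₂.sc) ((c₂.pt i).val / L ^ ℓ c₂.sc) = 0 := by
      exact_mod_cast le_antisymm hb (Nat.cast_nonneg _)
    have h01 := (cycd_eq_zero_iff_of_lt (hlt _) (hlt _)).1 h0
    -- `c₁`'s block = `c'`'s block (`blockIdx_toCell_eq`)
    have hdict := blockIdx_toCell_eq (a := ℓ c₁.sc) (e := e) hL hc hNdef D.hN y₁ i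
    rw [← he, ← hqe, ← hp, ← hpt₁] at hdict
    rw [← h01, hdict]
  have hcc : c' = c₂ := STCellV.ext_of hc'sc heq
  exact (hlat.sep τ hτ lam₁ h₁ lam₂ h₂ hne c' c₂ hc'in hc₂ hc'sc).1 hcc

/-- **LATERAL SEPARATION SUFFICES**: for `SkelOK` lineages along levels with `q u = L^{ℓ(u+1) − ℓ u}` (`ℓ` monotone,
`L > 0`), `LatSeparated ⇒ Separated`. [folklore] -/
theorem separated_of_lat (hL : 0 < L) (hmono : ∀ u, ℓ u ≤ ℓ (u + 1)) (hq : ∀ u, D.q u = L ^ (ℓ (u + 1) - ℓ u))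
    (hok : ∀ τ ∈ D.T, ∀ lam ∈ D.fam τ, SkelOK D.q D.step D.piece fat dC (D.G lam)) (hlat : D.LatSeparated) :
    D.Separated := by
  refine ⟨fun τ hτ lam₁ h₁ lam₂ h₂ hne c₁ c₂ hc₁ hc₂ => ⟨fun hcc => ?_, fun hadj => ?_⟩⟩
  · exact (hlat.sep τ hτ lam₁ h₁ lam₂ h₂ hne c₁ c₂ hc₁ hc₂ (by rw [hcc])).1 hcc
  · rw [stGraphV, SimpleGraph.fromRel_adj] at hadj
    obtain ⟨-, hrel | hrel⟩ := hadj
    · rcases hrel with ⟨hsc, hnear⟩ | ⟨hsc, hnear⟩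
      · exact (hlat.sep τ hτ lam₁ h₁ lam₂ h₂ hne c₁ c₂ hc₁ hc₂ hsc).2 hnear
      · exact D.no_vertical_edge hL hmono hq hlat hτ h₁ h₂ hne (hok τ hτ lam₁ h₁) hc₁ hc₂ hsc hnear
    · rcases hrel with ⟨hsc, hnear⟩ | ⟨hsc, hnear⟩
      · exact (hlat.sep τ hτ lam₂ h₂ lam₁ h₁ (Ne.symm hne) c₂ c₁ hc₂ hc₁ hsc).2 hnear
      · exact D.no_vertical_edge hL hmono hq hlat hτ h₂ h₁ (Ne.symm hne) (hok τ hτ lam₂ h₂) hc₂ hc₁ hsc hnear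

end LinData

end

end Summit.QuantumFields.BalabanUV.T4Continuum.SpaceTimePeierls
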